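import Mathlib
import HarnessLib
import Summits.HubbardSuperconductivity.HubbardSuperconductivity.Theorems.KLProgrammeKLRegimeSplitTwoLegMomentsFromPosition

/-!
# Route `KLProgramme` — ENGINE child 19855 / gen-5 EngineV13, two-leg stubs: the coefficient moments of the two-leg INCREMENT data
# `klLocSelfEnergyRe … (n+1) − klLocSelfEnergyRe … n` (the profiles of the pieces `ℓ_{n+1}`) from the spatial moments of the INCREMENT position
# kernel `W^{(n+1)} − W^{(n)}` (continuation of `…TwoLegMomentsFromPosition`, p485541)

Cell `gate-hubbard-kl`, seat p1b (g6).  The (E3a)/(E3c) clauses of the two-leg slot concern the PIECES `ℓ_{n+1} = E_μ(ν_{n+1} − ν_n)`, whose profile is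
read from the increment `S_{n+1} − S_n` of the two-leg interpolants; the engine's scale-`(n+1)` output is the increment of the position-space kernels.
Everything is linear in the Grassmann polynomial (`kernel_add`/`kernel_smul` ⇒ `selfEnergy_sub`, `sectorisedKernel_sub`), so `…TwoLegMomentsFromPosition`'s
bound applied to the DIFFERENCE action gives:

* `sum_weight_abs_torusCosCoeff_locAvg_sub_le` (generic `G₁, G₀`), **`sum_weight_abs_torusCosCoeff_klLocSelfEnergyRe_sub_le`**:
  `Σ_y (1+|ỹ₀|+|ỹ₁|)ʲ |torusCosCoeff L (klLocSelfEnergyRe … (n+1) − klLocSelfEnergyRe … n) y| ≤ 2·Mˢ` whenever the pinned spatial `j`-th moment of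
  `W_σ^{(n+1)} − W_σ^{(n)}` (unsectorised two-leg position kernels of `klEffectiveAction … klE0 (n+1)` and `… n`, both spins) is `≤ Mˢ`.

Everything is PROVED; no definitions; nothing about the model is asserted.  References: BGM 2006 (2.17), (2.36) [cite: BenfattoGiulianiMastropietro2006].
-/

noncomputable section

namespace Summit.HubbardSuperconductivity.HubbardSuperconductivity.Theorems.TwoLegFourier

set_option linter.dupNamespace false -- summit = problem name (single-conjunct summit), D-0017

open Finset Complex
open Literature.MathematicalPhysics.QuantumLattice Literature.Probability.LatticeModels GrassmannAlgebra
open Summit.HubbardSuperconductivity.HubbardSuperconductivity.Theorems.KLRegimeSplit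

variable {L M : ℕ} [NeZero L]

/-! ## §1 Linearity in the Grassmann polynomial; the increment data -/

omit [NeZero L] in
/-- Kernels of a difference. -/
theorem kernel_sub' (F G : HubbardGrassmann L M) (m : ℕ) (X : Fin m → HubbardFieldIdx L M) :
    kernel ℂ (F - G) m X = kernel ℂ F m X - kernel ℂ G m X := by
  rw [sub_eq_add_neg, kernel_add, ← neg_one_smul ℂ G, kernel_smul]
  ring

omit [NeZero L] in
/-- The self-energy is additive in the Grassmann polynomial: `Σ_{F−G} = Σ_F − Σ_G`. -/
theorem selfEnergy_sub (β : ℝ) (F G : HubbardGrassmann L M) (K : FreqMomentum L M) (σ : Fin 2) :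
    selfEnergy L M β (F - G) K σ = selfEnergy L M β F K σ - selfEnergy L M β G K σ := by
  simp only [selfEnergy, vertexFn_def, kernel_sub', mul_sub]

/-- The sectorised (here: position) kernels are additive in the Grassmann polynomial: `W_{F−G} = W_F − W_G`. -/
theorem sectorisedKernel_sub {N : ℕ} (β : ℝ) (Fm : Fin N → FreqMomentum L M → ℂ) (F G : HubbardGrassmann L M) (m : ℕ)
    (Ω : Fin m → SectorLeg N) (x : Fin m → SpaceTimeIdx L M) :
    sectorisedKernel L M β Fm (F - G) m Ω x = sectorisedKernel L M β Fm F m Ω x - sectorisedKernel L M β Fm G m Ω x := by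
  simp only [sectorisedKernel_def, kernel_sub', mul_sub, sum_sub_distrib]

section Increment

variable [NeZero M]

/-- **MOMENTS OF THE INCREMENT DATA FROM THE INCREMENT KERNEL.**  For two Grassmann polynomials `G₁, G₀` (e.g. the actions at scales `n+1`, `n`)
whose DIFFERENCE has unsectorised two-leg position kernels of pinned spatial `j`-th moment `≤ Mˢ` (both spin strings), the cosine coefficients of
the averaged real parts `k⃗ ↦ ¼ Σ_σ (Re Σ_{G₁}(±ω₀,k⃗,σ)) − ¼ Σ_σ (Re Σ_{G₀}(±ω₀,k⃗,σ))` have `j`-th moment `≤ 2·Mˢ`. -/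
theorem sum_weight_abs_torusCosCoeff_locAvg_sub_le {β : ℝ} (hβ : 0 < β) (G₁ G₀ : HubbardGrassmann L M) (j : ℕ) {Ms : ℝ}
    (hMs : ∀ (σ : Fin 2) (x₀ : SpaceTimeIdx L M), imagTimeWeight β M *
      ∑ x ∈ (univ : Finset (Fin 2 → SpaceTimeIdx L M)).filter (fun x => x 0 = x₀),
        (1 + ((((x 1).2 - (x 0).2) 0).valMinAbs.natAbs : ℝ) + ((((x 1).2 - (x 0).2) 1).valMinAbs.natAbs : ℝ)) ^ j *
          ‖sectorisedKernel L M β (trivialMultiplier L M) (G₁ - G₀) 2 (![((0, σ), 0), ((0, σ), 1)] : Fin 2 → SectorLeg 1) x‖ ≤ Ms) :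
    ∑ y : TorusSite 2 L, (1 + ((y 0).valMinAbs.natAbs : ℝ) + ((y 1).valMinAbs.natAbs : ℝ)) ^ j *
        |torusCosCoeff L (fun k =>
            (∑ σ : Fin 2, ((selfEnergy L M β G₁ (omega0 M, k) σ).re + (selfEnergy L M β G₁ ((omega0 M).rev, k) σ).re)) / 4 -
            (∑ σ : Fin 2, ((selfEnergy L M β G₀ (omega0 M, k) σ).re + (selfEnergy L M β G₀ ((omega0 M).rev, k) σ).re)) / 4) y|
      ≤ 2 * Ms := by
  set G := G₁ - G₀ with hG
  set w : TorusSite 2 L → ℝ := fun z => (1 + ((z 0).valMinAbs.natAbs : ℝ) + ((z 1).valMinAbs.natAbs : ℝ)) ^ j with hw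
  have hw0 : ∀ z, 0 ≤ w z := fun z => by rw [hw]; positivity
  set f : MatsubaraIdx M → Fin 2 → TorusSite 2 L → ℝ := fun m σ k => (selfEnergy L M β G (m, k) σ).re with hf
  -- the increment data as the average of four real parts of the DIFFERENCE polynomial
  have hdata : (fun k : TorusSite 2 L =>
      (∑ σ : Fin 2, ((selfEnergy L M β G₁ (omega0 M, k) σ).re + (selfEnergy L M β G₁ ((omega0 M).rev, k) σ).re)) / 4 -
        (∑ σ : Fin 2, ((selfEnergy L M β G₀ (omega0 M, k) σ).re + (selfEnergy L M β G₀ ((omega0 M).rev, k) σ).re)) / 4) =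
      fun k => (1 / 4 : ℝ) * ((f (omega0 M) 0 k + f (omega0 M).rev 0 k) + (f (omega0 M) 1 k + f (omega0 M).rev 1 k)) := by
    funext k
    simp only [hf, hG, selfEnergy_sub, Complex.sub_re, Fin.sum_univ_two]
    ring
  have hcoeff : ∀ y, torusCosCoeff L (fun k : TorusSite 2 L =>
      (∑ σ : Fin 2, ((selfEnergy L M β G₁ (omega0 M, k) σ).re + (selfEnergy L M β G₁ ((omega0 M).rev, k) σ).re)) / 4 -
        (∑ σ : Fin 2, ((selfEnergy L M β G₀ (omega0 M, k) σ).re + (selfEnergy L M β G₀ ((omega0 M).rev, k) σ).re)) / 4) y =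
      (1 / 4 : ℝ) * ((torusCosCoeff L (f (omega0 M) 0) y + torusCosCoeff L (f (omega0 M).rev 0) y) +
        (torusCosCoeff L (f (omega0 M) 1) y + torusCosCoeff L (f (omega0 M).rev 1) y)) := by
    intro y
    rw [hdata, torusCosCoeff_const_mul, torusCosCoeff_add L (fun k => f (omega0 M) 0 k + f (omega0 M).rev 0 k)
      (fun k => f (omega0 M) 1 k + f (omega0 M).rev 1 k), torusCosCoeff_add, torusCosCoeff_add]
  have hb : ∀ (m : MatsubaraIdx M) (σ : Fin 2), ∑ y, w y * |torusCosCoeff L (f m σ) y| ≤ 2 * Ms := fun m σ =>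
    sum_weight_abs_torusCosCoeff_re_selfEnergy_le hβ G m σ j (hMs σ)
  have hpt : ∀ y, w y * |torusCosCoeff L (fun k : TorusSite 2 L =>
      (∑ σ : Fin 2, ((selfEnergy L M β G₁ (omega0 M, k) σ).re + (selfEnergy L M β G₁ ((omega0 M).rev, k) σ).re)) / 4 -
        (∑ σ : Fin 2, ((selfEnergy L M β G₀ (omega0 M, k) σ).re + (selfEnergy L M β G₀ ((omega0 M).rev, k) σ).re)) / 4) y| ≤
      (1 / 4 : ℝ) * ((w y * |torusCosCoeff L (f (omega0 M) 0) y| + w y * |torusCosCoeff L (f (omega0 M).rev 0) y|) +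
        (w y * |torusCosCoeff L (f (omega0 M) 1) y| + w y * |torusCosCoeff L (f (omega0 M).rev 1) y|)) := by
    intro y
    rw [hcoeff, abs_mul, abs_of_pos (by norm_num : (0 : ℝ) < 1 / 4)]
    have h1 := abs_add_le (torusCosCoeff L (f (omega0 M) 0) y + torusCosCoeff L (f (omega0 M).rev 0) y)
      (torusCosCoeff L (f (omega0 M) 1) y + torusCosCoeff L (f (omega0 M).rev 1) y)
    have h2 := abs_add_le (torusCosCoeff L (f (omega0 M) 0) y) (torusCosCoeff L (f (omega0 M).rev 0) y)
    have h3 := abs_add_le (torusCosCoeff L (f (omega0 M) 1) y) (torusCosCoeff L (f (omega0 M).rev 1) y)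
    have hwy := hw0 y
    nlinarith
  calc _ ≤ ∑ y, (1 / 4 : ℝ) * ((w y * |torusCosCoeff L (f (omega0 M) 0) y| + w y * |torusCosCoeff L (f (omega0 M).rev 0) y|) +
          (w y * |torusCosCoeff L (f (omega0 M) 1) y| + w y * |torusCosCoeff L (f (omega0 M).rev 1) y|)) :=
        sum_le_sum fun y _ => hpt y
    _ = (1 / 4 : ℝ) * ((∑ y, w y * |torusCosCoeff L (f (omega0 M) 0) y| + ∑ y, w y * |torusCosCoeff L (f (omega0 M).rev 0) y|) +
          (∑ y, w y * |torusCosCoeff L (f (omega0 M) 1) y| + ∑ y, w y * |torusCosCoeff L (f (omega0 M).rev 1) y|)) := by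
        rw [← mul_sum, sum_add_distrib, sum_add_distrib, sum_add_distrib]
    _ ≤ (1 / 4 : ℝ) * ((2 * Ms + 2 * Ms) + (2 * Ms + 2 * Ms)) := by
        gcongr
        · exact hb _ _
        · exact hb _ _
        · exact hb _ _
        · exact hb _ _
    _ = 2 * Ms := by ring

/-- **MOMENTS OF THE CELL'S TWO-LEG INCREMENT `klLocSelfEnergyRe … (n+1) − klLocSelfEnergyRe … n` FROM THE INCREMENT KERNEL** — the profile data of
the piece `ℓ_{n+1}`: with `W_σ^{(m)}` the unsectorised two-leg position kernels of `klEffectiveAction … K klE0 m`, if the DIFFERENCE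
`W_σ^{(n+1)} − W_σ^{(n)}` has pinned spatial `j`-th moment `≤ Mˢ` (both spins), then
`Σ_y (1+|ỹ₀|+|ỹ₁|)ʲ |torusCosCoeff L (klLocSelfEnergyRe … (n+1) − klLocSelfEnergyRe … n) y| ≤ 2·Mˢ`. -/
theorem sum_weight_abs_torusCosCoeff_klLocSelfEnergyRe_sub_le {β : ℝ} (hβ : 0 < β) (U μ : ℝ) (K : TrigPolyC4v) (n j : ℕ) {Ms : ℝ}
    (hMs : ∀ (σ : Fin 2) (x₀ : SpaceTimeIdx L M), imagTimeWeight β M *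
      ∑ x ∈ (univ : Finset (Fin 2 → SpaceTimeIdx L M)).filter (fun x => x 0 = x₀),
        (1 + ((((x 1).2 - (x 0).2) 0).valMinAbs.natAbs : ℝ) + ((((x 1).2 - (x 0).2) 1).valMinAbs.natAbs : ℝ)) ^ j *
          ‖sectorisedKernel L M β (trivialMultiplier L M) (KLProgrammeLegKernels.klEffectiveAction L M β U μ K klE0 (n + 1)) 2
              (![((0, σ), 0), ((0, σ), 1)] : Fin 2 → SectorLeg 1) x -
            sectorisedKernel L M β (trivialMultiplier L M) (KLProgrammeLegKernels.klEffectiveAction L M β U μ K klE0 n) 2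
              (![((0, σ), 0), ((0, σ), 1)] : Fin 2 → SectorLeg 1) x‖ ≤ Ms) :
    ∑ y : TorusSite 2 L, (1 + ((y 0).valMinAbs.natAbs : ℝ) + ((y 1).valMinAbs.natAbs : ℝ)) ^ j *
        |torusCosCoeff L (fun k => klLocSelfEnergyRe L M β U μ K (n + 1) k - klLocSelfEnergyRe L M β U μ K n k) y| ≤ 2 * Ms := by
  have hdata : (fun k => klLocSelfEnergyRe L M β U μ K (n + 1) k - klLocSelfEnergyRe L M β U μ K n k) = fun k : TorusSite 2 L =>
      (∑ σ : Fin 2, ((selfEnergy L M β (KLProgrammeLegKernels.klEffectiveAction L M β U μ K klE0 (n + 1)) (omega0 M, k) σ).re +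
        (selfEnergy L M β (KLProgrammeLegKernels.klEffectiveAction L M β U μ K klE0 (n + 1)) ((omega0 M).rev, k) σ).re)) / 4 -
      (∑ σ : Fin 2, ((selfEnergy L M β (KLProgrammeLegKernels.klEffectiveAction L M β U μ K klE0 n) (omega0 M, k) σ).re +
        (selfEnergy L M β (KLProgrammeLegKernels.klEffectiveAction L M β U μ K klE0 n) ((omega0 M).rev, k) σ).re)) / 4 := by
    funext k; rfl
  rw [hdata]
  refine sum_weight_abs_torusCosCoeff_locAvg_sub_le hβ _ _ j fun σ x₀ => ?_
  refine le_trans (le_of_eq ?_) (hMs σ x₀)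
  congr 1
  refine sum_congr rfl fun x _ => ?_
  rw [sectorisedKernel_sub]

end Increment

end Summit.HubbardSuperconductivity.HubbardSuperconductivity.Theorems.TwoLegFourier

end
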